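import Mathlib.NumberTheory.Padics.PadicVal.Basic
import HarnessLib

/-!
# The ruler word of the first Grigorchuk group's orbital Schreier lines (combinatorial half of the D9 «bus lemma»)

builds on p205010 (kernel theorem, internal audit signed; external expert review pending) — nothing in this file uses p205010; it is pure
combinatorics on lists and 2-adic valuations (Mathlib `List` + `padicValNat`), with NO Grigorchuk-group import, NO percolation statement, NO
`@[conjecture]`, nothing about `θ(p_c)`.  Lane `prim-bschramm`, seat `prim-bschramm-stmt` gen 41 (port pen) under lead g28's TYPING GO #9088 and the
design desk's TYPING SPEC (p3 g41, #9104).  Helper file (`--supports stmt-CriticalPhenomena-4575 --as helper`).  It reopens nothing: the D9 line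
(«tail-aligned-component-skeleton») stays HOLD-class (VERDICTS :475 / :484 / :491).

THE OBJECT.  Grigorchuk–Lenz–Nagnibeda describe the labelled Schreier graphs of the first Grigorchuk group `𝔊 = ⟨a, b, c, d⟩` on the levels of the binary
tree (and on the boundary orbits) by the substitution / recursion `p⁽ⁿ⁺¹⁾ = p⁽ⁿ⁾ sₙ p⁽ⁿ⁾` (the connector letters `x, y, z` taken cyclically), the
`a`-edges being left implicit: the level-`n` Schreier graph is a path whose edges alternate between `a`-edges and «rungs» (double `{b,c,d}`-edges plus a
loop), and the word of rung types read along the path is `p⁽ⁿ⁾`.  This file types that word — `rulerWord n : List (Fin 3)` — and its 2-adic «ruler»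
structure: the `k`-th entry (0-indexed; it is the `(k+1)`-st RUNG, 1-indexed — THE INDEX CONVENTION OF THIS FILE) is the letter `s (v₂ (k+1))`
(`getElem_rulerWord`), where `v₂ = padicValNat 2` is the rung's «depth»; the word has length `2^n − 1`, is a palindrome, every aligned dyadic block of it
reads `rulerWord (d+1)` = «palindromic interior + centre `s d`» (`rulerWord_block` / `rulerWord_block_centre` — the window statement (R2) of the design
desk's §34.1 with minimal mirror radius `2^d − 1` rungs `= 2^(d+1) − 1` edges; the block's 2-adic address enters only beyond that radius), and the
BUS STEP (A1) in rung units (`bus_step`, `bus_step_next`, `bus_step_gap`): around a rung of depth exactly `d` the `2^d − 1` rungs to the East mirror the `2^d − 1` rungs to the West, and the next rung of depth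
`≥ d` is exactly `2^d` rungs `= 2^(d+1)` edges East — so, in EDGE units (docstring arithmetic, not a decl: consecutive entries are separated by one
`a`-edge, a rung's E-end and the next rung's W-end by one `a`-edge), the distance from a depth-`d` rung's E-end vertex to the next depth-`≥ d` rung's
W-end vertex is `2·2^d − 1 = 2^(d+1) − 1` edges = the minimal mirror radius.  GLN's CONVENTION vs OURS: their `p⁽ⁿ⁾ = τⁿ(a)` KEEPS the
`a`-letters (`|p⁽ⁿ⁾| = 2^(n+1) − 1`, `a` at the odd positions, Prop. 3.3); `rulerWord n` is `p⁽ⁿ⁾` with its `2^n` letters `a` deleted, so entry `k` here is position `2(k+1)` there, and Prop. 3.3 («`x, y, z` occur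
exactly at the positions `2^(3m+1)·odd, 2^(3m+2)·odd, 2^(3m+3)·odd`») is `getElem_rulerWord` (`v₂(2(k+1)) − 1 = v₂(k+1)`).
[cite: GrigorchukLenzNagnibeda2017, §3.1 (RF), Prop. 3.3, Prop. 3.5, Def. 3.6 / Thm. 3.7]

WHAT THIS FILE IS NOT (one sentence, per the spec).  The percolation reading of (A1) — two-sided, exact `e₁`-transport between consecutive deep rungs on
`Cay(𝔊 × ℤ; a, b, c, d, z)` by ONE symmetric input each way — additionally needs (L2) the identification of the orbital Schreier line's rung word with
`rulerWord` (GLN Thm. 3.7 at finite level: «the level-`n` Schreier path of `GrigorchukFiniteModel.modelT` has rung word `rulerWord n`», M–L, untyped)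
and (S7) the chart-level mirror law (law of the E-event at a rung's E-end = law of the W-event at its W-end via the left translation `L_{gsg⁻¹}` on
COMPONENT regions of the chart; O23-class, untyped); both stay design text, and D9 stays HOLD-class.  Everything below is combinatorial; NOTHING is a
Step-I corollary.

-- DATA (evidence that the abstract word matches the group's line — NOT proof; design desk p3 g41, HOME/prim-bschramm-p3-g41/out/u3q/):
--   ruler.py over the critic's quasisteps2.py, level Γ₁₂ (4096 vertices, 2047 rungs; depth := v₂ of the 1-indexed rung number): rungs of depth ≥ d are
--   spaced EXACTLY 2^(d+1) edges; the exits-free mirror radius of a depth-d rung (edges and vertex loops) is 2^(d+1) − 1 or 3·2^(d+1) − 1 edges,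
--   minimum = spacing − 1 (table d = 0..8: {1,5}, {3,11}, {7,23}, {15,47}, {31,95}, {63,191}, {127,383}, {255}, {511});
--   buscheck.py: 2026/2026 rungs of Γ₁₂ with both neighbours inside the model, 0 failures — radius ≥ 2^(d+1) − 1, next depth-≥d rung at +2^(d+1)
--   edges, the width-(2^(d+1) − 2) E-step from the E-end lands one a-edge West of that rung's W-end (the width-(2^(d+1) − 1) step exactly on it),
--   and the step's vertex window lies inside the fully mirrored window.

* §1 `s`, `rulerWord`, the two self-checks by `decide`.
* §2 THE arithmetic lemma (the ruler's local symmetry): `padicValNat_two_pow_mul_add` / `padicValNat_two_pow_mul_sub` —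
  `v₂ (2^d·m + r) = v₂ (2^d·m − r) = v₂ r` for `0 < r < 2^d`.
* §3 the closed form `rulerWord_eq_map` (5′), `length_rulerWord` (2), the RULER LAW `getElem_rulerWord` (4), the palindrome `reverse_rulerWord` (3),
  the spacing `rulerWord_spacing` (7).
* §4 the aligned-block window `rulerWord_block` / `rulerWord_block_centre` (5″; with `padicValNat_two_pow_mul_odd`, `depth_eq_of_eq_pow_mul_odd`:
  the centre of an aligned block has depth exactly `d`, so the spec's centre letter `s (v₂ ((2j+1)·2^d))` is `s d`) and the bus step `bus_step` /
  `bus_step_next` / `bus_step_next'` / `bus_step_gap` (6).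
-/

namespace Summit.CriticalPhenomena.PercolationContinuityZ3.Theorems.Transplant

namespace Grigorchuk

namespace Ruler

/-! ### §1 The connector letters and the ruler word -/

/-- The connector letter `sₙ ∈ {x, y, z} = Fin 3`, cyclic in `n`: `s n = n mod 3` (GLN's `sₙ = τⁿ(x) = x, y, z` for `n ≡ 0, 1, 2 (mod 3)`).
[cite: GrigorchukLenzNagnibeda2017, §3.1 (RF)] -/
def s (n : ℕ) : Fin 3 := ⟨n % 3, Nat.mod_lt _ (by decide)⟩

/-- **The ruler word** `p⁽ⁿ⁾` of GLN's substitution with the `a`-letters left implicit: `rulerWord 0 = []`, `rulerWord (n+1) = rulerWord n ++ [s n] ++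
rulerWord n` (GLN's `p⁽ⁿ⁾ = τⁿ(a)` with the `a`-letters deleted).  Entry `k` (0-indexed) is the `(k+1)`-st rung (1-indexed) of the level-`n` Schreier
path; consecutive rungs are joined through one `a`-edge. [cite: GrigorchukLenzNagnibeda2017, §3.1 (RF)] -/
def rulerWord : ℕ → List (Fin 3)
  | 0 => []
  | n + 1 => rulerWord n ++ [s n] ++ rulerWord n

/-- The defining recursion (RF), as a rewrite rule. [cite: GrigorchukLenzNagnibeda2017, §3.1 (RF)] -/
theorem rulerWord_succ (n : ℕ) : rulerWord (n + 1) = rulerWord n ++ [s n] ++ rulerWord n := rfl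

/-- `rulerWord 0 = []` (`p⁽⁰⁾ = a` has no connector). [cite: GrigorchukLenzNagnibeda2017, §3.1 (RF)] -/
@[simp] theorem rulerWord_zero : rulerWord 0 = [] := rfl

/-- Self-check (spec #9104): `p⁽³⁾ = x y x z x y x`. [folklore] -/
example : rulerWord 3 = [0, 1, 0, 2, 0, 1, 0] := by decide

/-- Self-check (spec #9104): `p⁽⁴⁾` is a palindrome. [folklore] -/
example : (rulerWord 4).reverse = rulerWord 4 := by decide

/-! ### §2 THE arithmetic lemma: the ruler's local symmetry `v₂ (2^d·m ± r) = v₂ r` for `0 < r < 2^d` -/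

/-- `v₂ r < d` for `0 < r < 2^d`. [folklore] -/
theorem padicValNat_two_lt_of_lt_pow {d r : ℕ} (hr0 : 0 < r) (hr : r < 2 ^ d) : padicValNat 2 r < d := by
  by_contra h
  have hdvd : 2 ^ d ∣ r := (padicValNat_dvd_iff_le hr0.ne').2 (not_lt.1 h)
  exact absurd (Nat.le_of_dvd hr0 hdvd) (not_le.2 hr)

/-- If `a + b` is a multiple of `2^d` and `0 < a < 2^d`, then `v₂ a = v₂ b` (the two halves of a dyadic block mirror each other's depths). [folklore] -/
theorem padicValNat_two_eq_of_add_eq {d m a b : ℕ} (ha0 : 0 < a) (ha : a < 2 ^ d) (h : a + b = 2 ^ d * m) :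
    padicValNat 2 b = padicValNat 2 a := by
  have hv : padicValNat 2 a < d := padicValNat_two_lt_of_lt_pow ha0 ha
  have hb0 : b ≠ 0 := by
    rintro rfl
    rw [add_zero] at h
    rcases Nat.eq_zero_or_pos m with rfl | hm
    · simp at h; exact ha0.ne' h
    · exact absurd (h ▸ Nat.le_mul_of_pos_right _ hm) (not_le.2 ha)
  -- `2^v ∣ b` and `¬ 2^(v+1) ∣ b`, where `v = v₂ a`
  have h1 : 2 ^ padicValNat 2 a ∣ b := by
    have hda : 2 ^ padicValNat 2 a ∣ a := pow_padicValNat_dvd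
    have hdm : 2 ^ padicValNat 2 a ∣ 2 ^ d * m := (pow_dvd_pow 2 hv.le).mul_right m
    rw [← h] at hdm
    exact (Nat.dvd_add_right hda).1 hdm
  have h2 : ¬ 2 ^ (padicValNat 2 a + 1) ∣ b := by
    intro hdb
    have hdm : 2 ^ (padicValNat 2 a + 1) ∣ 2 ^ d * m := (pow_dvd_pow 2 (Nat.succ_le_of_lt hv)).mul_right m
    rw [← h] at hdm
    exact pow_succ_padicValNat_not_dvd ha0.ne' ((Nat.dvd_add_left hdb).1 hdm)
  refine le_antisymm ?_ ((padicValNat_dvd_iff_le hb0).1 h1)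
  by_contra hlt
  exact h2 ((padicValNat_dvd_iff_le hb0).2 (Nat.succ_le_of_lt (not_le.1 hlt)))

/-- **The ruler's local symmetry, East side**: `v₂ (2^d·m + r) = v₂ r` for `0 < r < 2^d` (any `m`). [folklore] -/
theorem padicValNat_two_pow_mul_add {d m r : ℕ} (hr0 : 0 < r) (hr : r < 2 ^ d) :
    padicValNat 2 (2 ^ d * m + r) = padicValNat 2 r := by
  -- `(2^d − r) + (2^d·m + r) = 2^d·(m+1)` with `0 < 2^d − r < 2^d`, and `(2^d − r) + r = 2^d·1`
  have hsub0 : 0 < 2 ^ d - r := Nat.sub_pos_of_lt hr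
  have hsub : 2 ^ d - r < 2 ^ d := Nat.sub_lt (Nat.pos_of_ne_zero (by positivity)) hr0
  have e1 : padicValNat 2 (2 ^ d * m + r) = padicValNat 2 (2 ^ d - r) :=
    padicValNat_two_eq_of_add_eq hsub0 hsub (m := m + 1) (by rw [mul_add, mul_one]; omega)
  have e2 : padicValNat 2 r = padicValNat 2 (2 ^ d - r) :=
    padicValNat_two_eq_of_add_eq hsub0 hsub (m := 1) (by rw [mul_one]; omega)
  rw [e1, e2]

/-- **The ruler's local symmetry, West side**: `v₂ (2^d·m − r) = v₂ r` for `0 < r < 2^d` and `1 ≤ m`. [folklore] -/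
theorem padicValNat_two_pow_mul_sub {d m r : ℕ} (hm : 1 ≤ m) (hr0 : 0 < r) (hr : r < 2 ^ d) :
    padicValNat 2 (2 ^ d * m - r) = padicValNat 2 r :=
  padicValNat_two_eq_of_add_eq hr0 hr (m := m) (by
    have : 2 ^ d * 1 ≤ 2 ^ d * m := Nat.mul_le_mul_left _ hm
    omega)

/-! ### §3 Closed form, length, the ruler law, palindrome, spacing -/

/-- **(5′) Closed form**: `rulerWord n = [s (v₂ 1), s (v₂ 2), …, s (v₂ (2^n − 1))]` (GLN Prop. 3.3, positions of `x, y, z`). [cite: GrigorchukLenzNagnibeda2017, Prop. 3.3] -/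
theorem rulerWord_eq_map (n : ℕ) : rulerWord n = (List.range (2 ^ n - 1)).map (fun k => s (padicValNat 2 (k + 1))) := by
  induction n with
  | zero => simp
  | succ n ih =>
    have hpos : 1 ≤ 2 ^ n := Nat.one_le_two_pow
    have hsplit : 2 ^ (n + 1) - 1 = (2 ^ n - 1) + 1 + (2 ^ n - 1) := by rw [pow_succ]; omega
    rw [rulerWord_succ, hsplit, List.range_add, List.range_succ, List.map_append, List.map_append, List.map_map, ih]
    congr 1
    · -- the centre: `s n = s (v₂ (2^n))`
      rw [List.map_singleton, Nat.sub_add_cancel hpos, padicValNat.prime_pow]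
    · -- the East copy: `v₂ (2^n + (k+1)) = v₂ (k+1)` for `k + 1 < 2^n`
      refine List.map_congr_left fun k hk => ?_
      rw [List.mem_range] at hk
      simp only [Function.comp_apply]
      rw [show 2 ^ n - 1 + 1 + k + 1 = 2 ^ n * 1 + (k + 1) by omega, padicValNat_two_pow_mul_add (by omega) (by omega)]

/-- **(2) Length**: `|rulerWord n| = 2^n − 1` (the level-`n` block has `2^n − 1` rungs, `2^n` vertices; GLN: `|p⁽ⁿ⁾| = 2^(n+1) − 1` with the `a`'s). [cite: GrigorchukLenzNagnibeda2017, §3.1 (RF)] -/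
@[simp] theorem length_rulerWord (n : ℕ) : (rulerWord n).length = 2 ^ n - 1 := by
  rw [rulerWord_eq_map, List.length_map, List.length_range]

/-- **(4) THE RULER LAW**: the `k`-th entry (0-indexed) — the `(k+1)`-st rung, 1-indexed — is the letter `s (v₂ (k+1))`; its «depth» is `v₂ (k+1)`
(GLN Prop. 3.3: the connector at position `2^(j+1)·odd` of `η` is `s_j`). [cite: GrigorchukLenzNagnibeda2017, Prop. 3.3] -/
theorem getElem_rulerWord {n k : ℕ} (hk : k < (rulerWord n).length) : (rulerWord n)[k] = s (padicValNat 2 (k + 1)) := by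
  simp only [rulerWord_eq_map, List.getElem_map, List.getElem_range]

/-- **(3) Palindrome**: `rulerWord n` read backwards is itself (`v₂ (2^n − (k+1)) = v₂ (k+1)`; GLN §3.1: «an easy induction using (RF) shows that `p⁽ⁿ⁾` is a
palindrome», whence Prop. 3.5). [cite: GrigorchukLenzNagnibeda2017, §3.1 / Prop. 3.5] -/
theorem reverse_rulerWord (n : ℕ) : (rulerWord n).reverse = rulerWord n := by
  refine List.ext_getElem (by simp) fun k h1 h2 => ?_
  rw [length_rulerWord] at h2
  rw [List.getElem_reverse, getElem_rulerWord, getElem_rulerWord, length_rulerWord,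
    show 2 ^ n - 1 - 1 - k + 1 = 2 ^ n * 1 - (k + 1) by omega, padicValNat_two_pow_mul_sub le_rfl (by omega) (by omega)]

/-- **(7) Spacing**: the `(k+1)`-st rung has depth `≥ d` iff `2^d ∣ k+1` — so the rungs of depth `≥ d` are exactly every `2^d`-th rung (`2^(d+1)` edges
apart; GLN: the positions of the connectors of an `n`-decomposition form one class mod `2^(n+1)`). [cite: GrigorchukLenzNagnibeda2017, Prop. 3.3, Def. 3.6] -/
theorem rulerWord_spacing (d k : ℕ) : d ≤ padicValNat 2 (k + 1) ↔ 2 ^ d ∣ k + 1 :=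
  (padicValNat_dvd_iff_le k.succ_ne_zero).symm

/-! ### §4 The aligned-block window (R2) and the bus step (A1), in rung units -/

/-- The centre of an aligned dyadic block has depth EXACTLY `d`: `v₂ (2^d·(2j+1)) = d`. [folklore] -/
theorem padicValNat_two_pow_mul_odd (d j : ℕ) : padicValNat 2 (2 ^ d * (2 * j + 1)) = d := by
  rw [padicValNat.mul (by positivity) (by omega), padicValNat.prime_pow,
    padicValNat.eq_zero_of_not_dvd (by omega), add_zero]

/-- **(5″) Aligned dyadic blocks (the window statement (R2), minimal radius `2^d − 1` rungs = `2^(d+1) − 1` edges)**: for every `d`, `j` with the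
block inside the word (`(j+1)·2^(d+1) ≤ 2^n`), the `2^(d+1) − 1` consecutive entries starting at 0-indexed position `j·2^(d+1)` — i.e. the 1-indexed
rungs `j·2^(d+1) + 1, …, (j+1)·2^(d+1) − 1`, which is EXACTLY the radius-`(2^d − 1)`-rungs window around the rung `(2j+1)·2^d` of depth exactly `d`
(`padicValNat_two_pow_mul_odd`) — read `rulerWord (d+1)`: a palindrome (`reverse_rulerWord`) with centre letter `s d`.  (The spec's centre
`s (v₂ ((2j+1)·2^d))` IS `s d` for every `j`: the aligned block does not depend on its 2-adic address; the address enters only BEYOND radius `2^d − 1`,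
cf. the two radius families `{2^(d+1) − 1, 3·2^(d+1) − 1}` of the DATA block.)  This is the finite-word shadow of GLN's `d`-decomposition
`… p⁽ᵈ⁾ s₀ p⁽ᵈ⁾ s₁ p⁽ᵈ⁾ …` (Def. 3.6 / Thm. 3.7). [cite: GrigorchukLenzNagnibeda2017, §3.2 Def. 3.6, Thm. 3.7] -/
theorem rulerWord_block {n d j : ℕ} (h : (j + 1) * 2 ^ (d + 1) ≤ 2 ^ n) :
    ((rulerWord n).drop (j * 2 ^ (d + 1))).take (2 ^ (d + 1) - 1) = rulerWord (d + 1) := by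
  have hfit : 2 ^ (d + 1) - 1 ≤ 2 ^ n - 1 - j * 2 ^ (d + 1) := by rw [add_mul, one_mul] at h; omega
  have hlen : (((rulerWord n).drop (j * 2 ^ (d + 1))).take (2 ^ (d + 1) - 1)).length = 2 ^ (d + 1) - 1 := by
    rw [List.length_take, List.length_drop, length_rulerWord, min_eq_left hfit]
  refine List.ext_getElem (by rw [hlen, length_rulerWord]) fun i h1 h2 => ?_
  have hi : i < 2 ^ (d + 1) - 1 := by rw [hlen] at h1; exact h1
  rw [List.getElem_take, List.getElem_drop, getElem_rulerWord, getElem_rulerWord,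
    show j * 2 ^ (d + 1) + i + 1 = 2 ^ (d + 1) * j + (i + 1) by ring, padicValNat_two_pow_mul_add (by omega) (by omega)]

/-- **(5″), spelled with the centre**: the same block reads `rulerWord d ++ [s d] ++ rulerWord d` — palindromic interior + centre.
[cite: GrigorchukLenzNagnibeda2017, §3.1 (RF), Def. 3.6] -/
theorem rulerWord_block_centre {n d j : ℕ} (h : (j + 1) * 2 ^ (d + 1) ≤ 2 ^ n) :
    ((rulerWord n).drop (j * 2 ^ (d + 1))).take (2 ^ (d + 1) - 1) = rulerWord d ++ [s d] ++ rulerWord d := by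
  rw [rulerWord_block h, rulerWord_succ]

/-- The rung `k+1 = 2^d·(2j+1)` has depth exactly `d` (its letter is `s d`). [folklore] -/
theorem depth_eq_of_eq_pow_mul_odd {d j k : ℕ} (hk : k + 1 = 2 ^ d * (2 * j + 1)) : padicValNat 2 (k + 1) = d := by
  rw [hk, padicValNat_two_pow_mul_odd]

/-- **(6) BUS STEP (A1), rung units — the mirror**: around the rung `k+1 = 2^d·(2j+1)` (1-indexed; depth exactly `d`) the `2^d − 1` rungs
immediately East (0-indexed entries `k+1, …, k+2^d−1`) are the REVERSE of the `2^d − 1` rungs immediately West (0-indexed entries `k−2^d+1, …, k−1`),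
provided the East window fits (`(j+1)·2^(d+1) ≤ 2^n`; the West one always fits since `k ≥ 2^d − 1`).  In edge units: read from the E-end vertex of
rung `k+1` Eastwards and from its W-end vertex Westwards, the labelled line agrees letter by letter out to `2^(d+1) − 1` edges (odd offsets are
`a`-edges on both sides). [cite: GrigorchukLenzNagnibeda2017, §3.1 (RF) / Prop. 3.5, Thm. 3.7] -/
theorem bus_step {n d j k : ℕ} (hk : k + 1 = 2 ^ d * (2 * j + 1)) (h : (j + 1) * 2 ^ (d + 1) ≤ 2 ^ n) :
    ((rulerWord n).drop (k + 1)).take (2 ^ d - 1) = (((rulerWord n).take k).reverse).take (2 ^ d - 1) := by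
  have hd : 1 ≤ 2 ^ d := Nat.one_le_two_pow
  have hpow : 2 ^ (d + 1) = 2 * 2 ^ d := by rw [pow_succ, mul_comm]
  have hkn : k + 1 + 2 ^ d ≤ 2 ^ n := by
    rw [hk]
    calc 2 ^ d * (2 * j + 1) + 2 ^ d = (j + 1) * 2 ^ (d + 1) := by rw [hpow]; ring
      _ ≤ 2 ^ n := h
  have hkd : 2 ^ d ≤ k + 1 := by rw [hk]; exact Nat.le_mul_of_pos_right _ (by omega)
  have hfit : 2 ^ d - 1 ≤ 2 ^ n - 1 - (k + 1) := by omega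
  have hlenL : (((rulerWord n).drop (k + 1)).take (2 ^ d - 1)).length = 2 ^ d - 1 := by
    rw [List.length_take, List.length_drop, length_rulerWord, min_eq_left hfit]
  have hlenT : ((rulerWord n).take k).length = k := by
    rw [List.length_take, length_rulerWord, min_eq_left (by omega)]
  have hlenR : ((((rulerWord n).take k).reverse).take (2 ^ d - 1)).length = 2 ^ d - 1 := by
    rw [List.length_take, List.length_reverse, hlenT, min_eq_left (by omega)]
  refine List.ext_getElem (by rw [hlenL, hlenR]) fun i h1 h2 => ?_
  have hi : i < 2 ^ d - 1 := by rw [hlenL] at h1; exact h1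
  rw [List.getElem_take, List.getElem_drop, getElem_rulerWord, List.getElem_take, List.getElem_reverse, List.getElem_take,
    getElem_rulerWord]
  simp only [hlenT]
  rw [show k + 1 + i + 1 = 2 ^ d * (2 * j + 1) + (i + 1) by omega, padicValNat_two_pow_mul_add (by omega) (by omega),
    show k - 1 - i + 1 = 2 ^ d * (2 * j + 1) - (i + 1) by omega,
    padicValNat_two_pow_mul_sub (by omega) (by omega) (by omega)]

/-- **(6) BUS STEP (A1) — the landing**: the rung `2^d` places East of a rung `k+1` with `2^d ∣ k+1` again has depth `≥ d` (indeed `v₂ (k+1+2^d) ≥ d`;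
if `k+1 = 2^d·(2j+1)` it is `2^(d+1)·(j+1)`, depth `≥ d+1`).  EDGE ARITHMETIC (not a decl): E-end of rung `k+1` → W-end of rung `k+1+2^d` is
`2·2^d − 1 = 2^(d+1) − 1` edges = the minimal mirror radius, so the `e₁`-input of that width centred at the E-end LANDS EXACTLY on the next deep rung's
W-end column. [cite: GrigorchukLenzNagnibeda2017, Prop. 3.3] -/
theorem bus_step_next {d k : ℕ} (hk : 2 ^ d ∣ k + 1) : d ≤ padicValNat 2 (k + 1 + 2 ^ d) := by
  rw [show k + 1 + 2 ^ d = k + 2 ^ d + 1 by omega]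
  exact (rulerWord_spacing d (k + 2 ^ d)).2 (by rw [show k + 2 ^ d + 1 = (k + 1) + 2 ^ d by omega]; exact dvd_add hk dvd_rfl)

/-- **(6) BUS STEP (A1) — the landing, sharp form**: for `k+1 = 2^d·(2j+1)` the rung `2^d` places East has depth `≥ d+1`.
[cite: GrigorchukLenzNagnibeda2017, Prop. 3.3] -/
theorem bus_step_next' {d j k : ℕ} (hk : k + 1 = 2 ^ d * (2 * j + 1)) : d + 1 ≤ padicValNat 2 (k + 1 + 2 ^ d) := by
  rw [show k + 1 + 2 ^ d = k + 2 ^ d + 1 by omega]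
  exact (rulerWord_spacing (d + 1) (k + 2 ^ d)).2
    ⟨j + 1, by rw [show k + 2 ^ d + 1 = (k + 1) + 2 ^ d by omega, hk, pow_succ]; ring⟩

/-- **(6) BUS STEP (A1) — no deep rung in between**: strictly between a rung `k+1` with `2^d ∣ k+1` and the rung `2^d` places East every rung is
shallower than `d` (`v₂ (k+1+i) = v₂ i < d` for `0 < i < 2^d`): the NEXT rung of depth `≥ d` is exactly `2^d` rungs = `2^(d+1)` edges East.
[cite: GrigorchukLenzNagnibeda2017, Prop. 3.3] -/
theorem bus_step_gap {d k i : ℕ} (hk : 2 ^ d ∣ k + 1) (hi0 : 0 < i) (hi : i < 2 ^ d) : padicValNat 2 (k + 1 + i) < d := by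
  obtain ⟨m, hm⟩ := hk
  rw [hm, padicValNat_two_pow_mul_add hi0 hi]
  exact padicValNat_two_lt_of_lt_pow hi0 hi

end Ruler

end Grigorchuk

end Summit.CriticalPhenomena.PercolationContinuityZ3.Theorems.Transplant
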